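import Summits.Parity.GeneralizedHardyLittlewood.Theorems.MaynardProductExactGlue
import Summits.Parity.GeneralizedHardyLittlewood.Theorems.MaynardProductExactNumLB3749
import Summits.Parity.GeneralizedHardyLittlewood.Theorems.MaynardProductExactDenUB3750

/-! # Route `MaynardProductExact` — support `MkCert3750` (stmt-Parity-19252) CLOSED

`M_3750 > 8`: there is a Maynard-admissible `F : (Fin 3750 → ℝ) → ℝ` with `maynardFunctional 3750 F > 8`
(witness: the product test function of the profile `polymathProfile 3750 (249/2000) (3/4)`), obtained BY NAME as the
route's proved certificate glue `certGlue_holds : NumLB3749 → DenUB3750 → MkCert3750`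
(`Theorems/MaynardProductExactGlue.lean`, key arithmetic `8·0.41694·m₂ < 3750·1.9076·10⁻⁶`) applied to the two landed
kernel certificates `numLB3749_proof` (stmt-Parity-19245) and `denUB3750_proof` (stmt-Parity-19251).
Rung F-P1.R4 bookkeeping only; no summit is proved by this file. -/

namespace Summit.Parity.GeneralizedHardyLittlewood.MaynardProductExactMkCert3750

open Summit.Parity.GeneralizedHardyLittlewood.Theses.MaynardProductExact

/-- **Support `MkCert3750` (stmt-Parity-19252), by name:** `∃ F, IsMaynardAdmissible 3750 F ∧ 8 < maynardFunctional 3750 F`,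
from the kernel certificates `NumLB3749`, `DenUB3750` through the route's proved glue `certGlue_holds`. -/
theorem mkCert3750_proof : Summit.Parity.GeneralizedHardyLittlewood.Theses.MaynardProductExact.MkCert3750 :=
  certGlue_holds MaynardProductExactNumLB3749.numLB3749_proof MaynardProductExactDenUB3750.denUB3750_proof

end Summit.Parity.GeneralizedHardyLittlewood.MaynardProductExactMkCert3750
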